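import Summits.ResolutionOfSingularities.ResolutionOfSingularities.Theorems.StallVertexDeficiency
import HarnessLib

/-!
# StallVertexDeficiencyLaw — decomp-res node «StallVertex» (lens-5 g22 rev 7/8), add-on tree file 19 of the node

Content VERBATIM from the decomp-res lens-5 file `HOME/decomp-res-lens-5/g22/StallVertex.lean` rev 8 (pin 9799ca34,
4 539 l; rev 8 = rev 7 25c16fe6 +
five pure insertions §1j/§1k/§2d/§3i/§4i/§4j; rev 7 = pure insertions §2c/§4h over the landed rev-6 content
95ed6f6f — all earlier statements
byte-identical (critic machine diffs, CRITIC-LEDGER rows 142g / 142h); HOME = run/shared/lean/pub/decomp-res).  The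
rev-0…6 sections are ALREADY in the
tree (`StallVertexForms` / `Kernels` / `Walk` / `Classes` / `Clean` / `Rigid` / `Lines` / `RigidClasses` / `Carry` /
`OldLetter` / `LineTurn` /
`LetterClasses` / `Regime` / `StraightClasses` + wiring `MaxContactCutStallVertex` /
`MaxContactCutStallVertexEvents`, writer g7/g8); the rev-7/8 add-on
files carry ONLY the 53 declarations NEW in rev 7 / rev 8.  Critic: CRITIC-LEDGER row 142g (rev 7, DECIDED +1 (Y):
THE DEFICIENCY LAW — the positive
young-monomial regime is EMPTY, positive differential shade is an interference phenomenon, exact re-location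
`monomialRegime_iff_flat`; inhabitants
T-regime 3 353/116; 2026-08-30T23:43:05Z) and row 142h (rev 8, BOOKED 0: RESONANCE / ECHO / NULL / COINCIDENCE laws
+ the exact two-leaf split
`defectWalksDeep_iff_positive_nullFlat`; 2026-08-31T00:03:14Z) — landing orders INBOX :525 / :543.  Landed by
decomp-res writer g9 as
`StallVertexEcho` (§1j + §1k + §3i), `StallVertexDeficiency` (§2c + §2d), `StallVertexDeficiencyLaw` (§4h
kernels: `FlatMonomialAt` … `muTilde_eq_zero_of_regime`),
`StallVertexFlatClasses` (§4h cells and exact re-locations), `StallVertexNullClasses` (§4i + §4j cells and exact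
re-locations) and the wiring file
`MaxContactCutStallVertexFlat` (every new `closes_…` / `defectWalksDeep_iff_…` BY NAME on
`MaxContactCut.DefectWalksDeep`).  All
`--supports stmt-ResolutionOfSingularities-31770`.  Every file of the node is in the Theses cone (the lens imports
the in-cone `DifferentialShade`), so the
located residual is booked on the route by RE-LOCATING the existing aside 28122 `CFNoSkewJointTailsDeep` (informal-only edit) to
`StallVertex.NoFlatRegimeSkewStalledTailsDeep` ≡ `NoPositiveSkewStalledTailsDeep ∧
NoNullFlatSkewStalledTailsDeep` (EXACT, hypothesis-free chain
skew ↔ … ↔ monomialRegime ↔ flat ↔ positive ∧ nullFlat: `skew_iff_flat`, `skew_iff_positive_nullFlat`)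
— one aside on this column (critic rows 142g/142h:
«file only the newest, exactly one aside on the column; decided cells and the μ̃-sign leaves NOT filed»).

§4h part 1 (rev 7, `section Classes`) THE DEFICIENCY LAW (kernels on the tails): `FlatMonomialAt` (support
definition: the young monomial cone of the
minimiser is FLAT — a boundary monomial, `μ̃ = 0`), `youngMonomialAt_of_flatMonomialAt`,
`muTilde_eq_zero_of_flatMonomialAt`, `cone_is_boundary_of_flatMonomialAt`,
**`deficiency_step`** / **`deficiency_iterate`** / **`eventually_flat`** (along a clean young-monomial regime the
deficiency is monotone and the cone becomes
flat in finite time), `muTilde_eq_zero_of_regime`.  PROVED, 0 sorry.  Imports `StallVertexDeficiency`.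

[WRITER NOTE (decomp-res writer g9): file split only; namespace, opens, section variables and every declaration
exactly as in the lens (global `set_option` dropped; the lens's `set_option maxHeartbeats … in` lines kept; the
lens's private copy `flat_monomial'` of the landed
`Literature.AlgebraicGeometry.Resolution.PointBlowup.flat_monomial` is cited by its full name, as in `StallVertexCarry`).]

(Sources: KawanoueMatsuki2016 Prop. 4 (2), §4.1; Kawanoue2007 Lemma 2.2.1.2; BierstoneGrigorievMilmanWlodarczyk2011
Def. 3.1.3; Hauser2010; HauserPerlega2024; Moh1987; CossartPiltant2008; Giraud1975; Hironaka1964; ZariskiSamuelII Ch. VIII §2.)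
-/

noncomputable section

open MvPolynomial Finset
open Literature.AlgebraicGeometry.Resolution
open Literature.AlgebraicGeometry.Resolution.Hauser2010
open Literature.AlgebraicGeometry.Resolution.HauserPerlega2024
open Literature.Barriers.ResolutionOfSingularities
open Literature.AlgebraicGeometry.Resolution.PointBlowup
open Summit.ResolutionOfSingularities.ResolutionOfSingularities.Theses
open Summit.ResolutionOfSingularities.ResolutionOfSingularities.Theorems.TightDefectClasses
open Summit.ResolutionOfSingularities.ResolutionOfSingularities.Theorems.ProximityCut
open Summit.ResolutionOfSingularities.ResolutionOfSingularities.Theorems.ExitLaw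
open Summit.ResolutionOfSingularities.ResolutionOfSingularities.Theorems.DifferentialShade

namespace Summit.ResolutionOfSingularities.ResolutionOfSingularities.Theorems.StallVertex

section Classes

/-! ### §4h (rev 7, generation 22) THE DEFICIENCY LAW: THE POSITIVE MONOMIAL REGIME IS EMPTY; THE RESIDUAL IS THE FLAT REGIME

In a clean stalled monomial regime follow ONE minimiser `J₀` (it persists, `monomial_step`) and its young monomial cone
`ρ_t·u^{S(t)}`.  The DEFICIENCY `δ_i(t) = S_i(t) − a₀ μ_{P,D_i}(t) ≥ 0` (§2c) of a young letter obeys three laws: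
a LOST letter is non-deficient at the move that loses it (`lost_nondeficient`), the NEW letter is born non-deficient
(`new_nondeficient`), a KEPT non-deficient letter stays non-deficient (`kept_nondeficient`).  Hence
(`deficiency_iterate`) every young letter lost at least once since the regime began is non-deficient, and under the
SKEW binder (every letter is lost again and again) the regime is EVENTUALLY FLAT (`eventually_flat`): from some time on
EVERY young letter is non-deficient — the cone monomial `u^S` IS Kawanoue–Matsuki's boundary monomial
`(∏_{young} u_i^{μ_{P,D_i}})^{a₀}` — and `μ̃ = Σ_young δ_i / a₀ ≡ 0` (`muTilde_eq_zero_of_flatMonomialAt`,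
`muTilde_eq_zero_of_regime`).  CONSEQUENCES: the cell (h″) «clean monomial regime with `μ̃ > 0`» is EMPTY
(`noPositiveMonomialRegimeSkewStalledTailsDeep_holds`); a line-free rigid skew stalled tail of POSITIVE differential
shade is UNCLEAN INFINITELY OFTEN (`unclean_io_of_muTilde_pos`: K–M's general case `μ̃ > 0` survives forever only
through infinitely many cleaning interferences); and the located residual is re-located EXACTLY as
«INTERFERENCE ∨ THE FLAT REGIME» (`monomialRegime_iff_flat`, `skew_iff_flat`, `closes_flat`, `defectWalksDeep_iff_flat`). -/

/-- A FLAT YOUNG MONOMIAL at time `t`: a young monomial cone `ρ·u^S` of a `μ_P`-minimiser `J₀` (level `a₀ = q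
− |J₀|`)
such that EVERY young letter carries exactly its share of the cone, `μ_{P,D_i} = S_i / a₀` (zero deficiency) — the
cone monomial is the `a₀`-th power of the boundary monomial `∏_{young} u_i^{μ_{P,D_i}}` of the unit, and `μ̃
= 0`. (Sources: KawanoueMatsuki2016, §4.1 and §5.3 (the monomial `Mon(ℛ)` of the monomial case); new as a walk
predicate.) -/
def FlatMonomialAt {K : Type} [Field K] [DecidableEq K] {q : ℕ} {s₀ : State (Fin 3) K} (W : ForcedWalk q s₀) (t : ℕ) : Prop :=
  ∃ J₀ ∈ (ifp W t).idx, (ifp W t).muP q = levelRatio (ordZero ((ifp W t).gen J₀)) (q - J₀.degree) ∧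
    ∃ (S : Fin 3 →₀ ℕ) (ρ : K), ρ ≠ 0 ∧ ordZero ((ifp W t).gen J₀) = ((S.degree : ℕ) : ℕ∞) ∧
      homogeneousComponent S.degree ((ifp W t).gen J₀) = monomial S ρ ∧ (∀ i, S i ≠ 0 → i ∈ (ifp W t).young) ∧
      ∀ i ∈ (ifp W t).young, (ifp W t).muPD q i = ((((S i : ℕ) : ℚ) / (q - J₀.degree : ℕ) : ℚ) : WithTop ℚ)

/-- A flat young monomial is a young monomial. [folklore] -/
theorem youngMonomialAt_of_flatMonomialAt {K : Type} [Field K] [DecidableEq K] {q : ℕ} {s₀ : State (Fin 3) K}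
    (W : ForcedWalk q s₀) (t : ℕ) (h : FlatMonomialAt W t) : YoungMonomialAt W t := by
  obtain ⟨J₀, hJ₀, hμ, S, ρ, hρ, hd₀, hG, hyoung, -⟩ := h
  exact ⟨J₀, hJ₀, hμ, S, ρ, hρ, hd₀, hG, hyoung⟩

/-- **`μ̃ = 0` AT A FLAT YOUNG MONOMIAL**: `μ̃ = |S|/a₀ − Σ_young S_i/a₀ = 0` (`S` is young-supported).
[new] [folklore] -/
theorem muTilde_eq_zero_of_flatMonomialAt {K : Type} [Field K] [DecidableEq K] {q : ℕ} {s₀ : State (Fin 3) K}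
    (W : ForcedWalk q s₀) (t : ℕ) (h : FlatMonomialAt W t) : (ifp W t).muTilde q = 0 := by
  classical
  obtain ⟨J₀, -, hμ, S, ρ, -, hd₀, -, hyoung, hflat⟩ := h
  rw [muTilde_eq_at q (ifp W t) hμ hd₀]
  have hsum : ∑ i ∈ (ifp W t).young, ((ifp W t).muPD q i).untopD 0 =
      ∑ i ∈ (ifp W t).young, ((S i : ℕ) : ℚ) / (q - J₀.degree : ℕ) := by
    refine Finset.sum_congr rfl fun i hi => ?_
    rw [hflat i hi, WithTop.untopD_coe]
  have hdeg : ((S.degree : ℕ) : ℚ) = ∑ i ∈ (ifp W t).young, ((S i : ℕ) : ℚ) := by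
    rw [Finsupp.degree_eq_sum, Nat.cast_sum]
    symm
    refine Finset.sum_subset (Finset.subset_univ _) fun i _ hi => ?_
    have hSi : S i = 0 := by
      by_contra hne
      exact hi (hyoung i hne)
    rw [hSi, Nat.cast_zero]
  rw [hsum, ← Finset.sum_div, ← hdeg, sub_self, WithTop.coe_zero]

/-- **IN THE FLAT REGIME THE CONE IS THE BOUNDARY MONOMIAL**: at a flat young monomial `ρ·u^S` of the minimiser
`J₀`, EVERY monomial of the carried derivative `g_{J₀}` is a multiple of `u^S` — `g_{J₀} = u^S·(ρ + higher terms)` is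
`u^S` times a UNIT, `u^S = (∏_{young} u_i^{μ_{P,D_i}})^{a₀}` being the `a₀`-th power of Kawanoue–Matsuki's monomial
`Mon(ℛ)` of the unit. (Sources: KawanoueMatsuki2016, §5.3; new as a walk law.) -/
theorem cone_is_boundary_of_flatMonomialAt {K : Type} [Field K] [DecidableEq K] {q : ℕ} {s₀ : State (Fin 3) K}
    (W : ForcedWalk q s₀) (t : ℕ) (h : FlatMonomialAt W t) :
    ∃ J₀ ∈ (ifp W t).idx, (ifp W t).muP q = levelRatio (ordZero ((ifp W t).gen J₀)) (q - J₀.degree) ∧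
      ∃ (S : Fin 3 →₀ ℕ) (ρ : K), ρ ≠ 0 ∧ ordZero ((ifp W t).gen J₀) = ((S.degree : ℕ) : ℕ∞) ∧
        homogeneousComponent S.degree ((ifp W t).gen J₀) = monomial S ρ ∧ (∀ i, S i ≠ 0 → i ∈ (ifp W t).young) ∧
        (∀ i ∈ (ifp W t).young, divisorOrder i ((ifp W t).gen J₀) = ((S i : ℕ) : ℕ∞)) ∧
        ∀ m ∈ ((ifp W t).gen J₀).support, S ≤ m := by
  obtain ⟨J₀, hJ₀, hμ, S, ρ, hρ, hd₀, hG, hyoung, hflat⟩ := h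
  have hS : S ∈ ((ifp W t).gen J₀).support := mem_support_of_cone hρ hG
  have hlev : J₀.degree < q := (level_bounds W t J₀ hJ₀).2
  have hdiv : ∀ i ∈ (ifp W t).young, divisorOrder i ((ifp W t).gen J₀) = ((S i : ℕ) : ℕ∞) := fun i hi =>
    divisorOrder_eq_of_nondeficient q (ifp W t) hJ₀ hlev hS (hflat i hi)
  refine ⟨J₀, hJ₀, hμ, S, ρ, hρ, hd₀, hG, hyoung, hdiv, fun m hm => ?_⟩
  intro i
  by_cases hi : i ∈ (ifp W t).young
  · have h1 : ((S i : ℕ) : ℕ∞) ≤ (m i : ℕ∞) := (hdiv i hi) ▸ divisorOrder_le_exponent hm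
    exact_mod_cast h1
  · have hSi : S i = 0 := by
      by_contra hne
      exact hi (hyoung i hne)
    rw [hSi]
    exact Nat.zero_le _

/-- **THE DEFICIENCY STEP** (walk level).  At a clean stalled move in the monomial regime follow the minimiser `J₀` with
young monomial cone `ρ·u^S`: at `t + 1` its cone is the young monomial `ρ'·u^{S'}` of `monomial_step`; the NEW letter
`j_t` is NON-DEFICIENT (`μ_{P',D_{j_t}} = S'_{j_t}/a₀`); a KEPT letter (`i ≠ j_t`, `b_t i = 0`) has `S'_i = S_i`, and
if it was non-deficient it stays non-deficient. [new] [folklore] -/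
theorem deficiency_step {K : Type} [Field K] [DecidableEq K] {p e : ℕ} (hp : p.Prime) [CharP K p]
    {s₀ : State (Fin 3) K} (hs : IsRoot (p ^ e) s₀) (W : ForcedWalk (p ^ e) s₀) (t : ℕ)
    (hst : (ifp W (t + 1)).muTilde (p ^ e) = (ifp W t).muTilde (p ^ e)) (hcl : CleanAt W t)
    {J₀ : Fin 3 →₀ ℕ} (hJ₀ : J₀ ∈ (ifp W t).idx)
    (hμ : (ifp W t).muP (p ^ e) = levelRatio (ordZero ((ifp W t).gen J₀)) (p ^ e - J₀.degree))
    (S : Fin 3 →₀ ℕ) {ρ : K} (hρ : ρ ≠ 0) (hd₀ : ordZero ((ifp W t).gen J₀) = ((S.degree : ℕ) : ℕ∞))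
    (hG : homogeneousComponent S.degree ((ifp W t).gen J₀) = monomial S ρ)
    (hyoung : ∀ i, S i ≠ 0 → i ∈ (ifp W t).young) :
    ∃ (S' : Fin 3 →₀ ℕ) (ρ' : K), ρ' ≠ 0 ∧ J₀ ∈ (ifp W (t + 1)).idx ∧
      (ifp W (t + 1)).muP (p ^ e) = levelRatio (ordZero ((ifp W (t + 1)).gen J₀)) (p ^ e - J₀.degree) ∧
      ordZero ((ifp W (t + 1)).gen J₀) = ((S'.degree : ℕ) : ℕ∞) ∧
      homogeneousComponent S'.degree ((ifp W (t + 1)).gen J₀) = monomial S' ρ' ∧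
      (∀ i, S' i ≠ 0 → i ∈ (ifp W (t + 1)).young) ∧
      (ifp W (t + 1)).muPD (p ^ e) (W.j t) =
        ((((S' (W.j t) : ℕ) : ℚ) / (p ^ e - J₀.degree : ℕ) : ℚ) : WithTop ℚ) ∧
      (∀ i, i ≠ W.j t → W.b t i = 0 → S' i = S i) ∧
      (∀ i, i ≠ W.j t → W.b t i = 0 →
        (ifp W t).muPD (p ^ e) i = ((((S i : ℕ) : ℚ) / (p ^ e - J₀.degree : ℕ) : ℚ) : WithTop ℚ) →
        (ifp W (t + 1)).muPD (p ^ e) i = ((((S' i : ℕ) : ℚ) / (p ^ e - J₀.degree : ℕ) : ℚ) : WithTop ℚ)) := by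
  classical
  obtain ⟨hJ₁, hμ₁, ha, hd₁, hG₁⟩ := monomial_step hp hs W t hst hcl hJ₀ hμ S hρ hd₀ hG
  set S' : Fin 3 →₀ ℕ := Finsupp.single (W.j t) (S.degree - (p ^ e - J₀.degree)) +
    (S.erase (W.j t)).filter (fun i => W.b t i = 0) with hS'
  set ρ' : K := ρ * ∏ i ∈ univ.filter (fun i => W.b t i ≠ 0), W.b t i ^ ((S.erase (W.j t)) i) with hρ'
  have hdeg : S'.degree = S.degree - (p ^ e - J₀.degree) + ((S.erase (W.j t)).filter (fun i => W.b t i = 0)).degree := by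
    rw [hS', map_add, Finsupp.degree_single]
  have hρ'ne : ρ' ≠ 0 :=
    mul_ne_zero hρ (Finset.prod_ne_zero_iff.mpr fun i hi => pow_ne_zero _ (Finset.mem_filter.mp hi).2)
  have hd₁' : ordZero ((ifp W (t + 1)).gen J₀) = ((S'.degree : ℕ) : ℕ∞) := by rw [hdeg]; exact hd₁
  have hG₁' : homogeneousComponent S'.degree ((ifp W (t + 1)).gen J₀) = monomial S' ρ' := by rw [hdeg]; exact hG₁
  have hS'j : S' (W.j t) = S.degree - (p ^ e - J₀.degree) := by
    rw [hS', Finsupp.add_apply, Finsupp.single_eq_same, Finsupp.filter_apply, Finsupp.erase_same, ite_self, add_zero]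
  have hS'kept : ∀ i, i ≠ W.j t → W.b t i = 0 → S' i = S i := by
    intro i hij hbi
    rw [hS', Finsupp.add_apply, Finsupp.single_eq_of_ne hij, zero_add, Finsupp.filter_apply, if_pos hbi,
      Finsupp.erase_ne hij]
  have hyoung' : ∀ i, S' i ≠ 0 → i ∈ (ifp W (t + 1)).young := by
    intro i hi
    rw [ifp_succ]
    show i ∈ insert (W.j t) ((ifp W t).young.filter fun i => W.b t i = 0)
    rw [Finset.mem_insert, Finset.mem_filter]
    by_cases hij : i = W.j t
    · exact Or.inl hij
    · right
      by_cases hbi : W.b t i = 0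
      · rw [hS'kept i hij hbi] at hi
        exact ⟨hyoung i hi, hbi⟩
      · rw [hS', Finsupp.add_apply, Finsupp.single_eq_of_ne hij, zero_add, Finsupp.filter_apply, if_neg hbi] at hi
        exact absurd rfl hi
  -- the generic laws at the corner state `ifp W t`, move `(W.j t, W.b t)`
  have hlev : ∀ J ∈ (ifp W t).idx, J.degree < p ^ e := fun J hJ => (level_bounds W t J hJ).2
  have hstall : (ifp W t).muTilde (p ^ e) ≤ ((ifp W t).step (p ^ e) (W.j t) (W.b t)).muTilde (p ^ e) := by
    rw [← ifp_succ]; exact hst.symm.le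
  have hnew := new_nondeficient (p ^ e) (W.j t) (W.b t) (W.onExc t) (ifp W t) hlev (sing_ifp hp hs W t) hstall
    hJ₀ hμ hd₀
  refine ⟨S', ρ', hρ'ne, hJ₁, hμ₁, hd₁', hG₁', hyoung', ?_, hS'kept, ?_⟩
  · rw [hS'j, ifp_succ]; exact hnew
  · intro i hij hbi hx
    have hS'supp : S' ∈ (((ifp W t).step (p ^ e) (W.j t) (W.b t)).gen J₀).support := by
      rw [← ifp_succ]; exact mem_support_of_cone hρ'ne hG₁'
    rw [ifp_succ]
    refine kept_nondeficient (p ^ e) (W.j t) (W.b t) (ifp W t) hJ₀ hij hbi hS'supp ?_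
    rw [hS'kept i hij hbi]; exact hx

/-- **THE DEFICIENCY LAW, ITERATED.**  In a clean stalled monomial regime from `N₁`, follow the minimiser of the young
monomial at `N₁`: at every time `N₁ + n` its cone is a young monomial `ρ·u^S`, and EVERY YOUNG LETTER LOST AT LEAST
ONCE SINCE `N₁` (`∃ s, N₁ ≤ s < N₁ + n, j_s = i ∨ b_s i ≠ 0`) IS NON-DEFICIENT, `μ_{P,D_i} = S_i /
a₀`. [new] [folklore] -/
theorem deficiency_iterate {K : Type} [Field K] [DecidableEq K] {p e : ℕ} (hp : p.Prime) [CharP K p]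
    {s₀ : State (Fin 3) K} (hs : IsRoot (p ^ e) s₀) (W : ForcedWalk (p ^ e) s₀) (N₁ : ℕ)
    (hst : ∀ t, N₁ ≤ t → (ifp W (t + 1)).muTilde (p ^ e) = (ifp W t).muTilde (p ^ e))
    (hcl : ∀ t, N₁ ≤ t → CleanAt W t) (hy : YoungMonomialAt W N₁) (n : ℕ) :
    ∃ J₀ ∈ (ifp W (N₁ + n)).idx,
      (ifp W (N₁ + n)).muP (p ^ e) = levelRatio (ordZero ((ifp W (N₁ + n)).gen J₀)) (p ^ e - J₀.degree) ∧
      ∃ (S : Fin 3 →₀ ℕ) (ρ : K), ρ ≠ 0 ∧ ordZero ((ifp W (N₁ + n)).gen J₀) = ((S.degree : ℕ) : ℕ∞) ∧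
        homogeneousComponent S.degree ((ifp W (N₁ + n)).gen J₀) = monomial S ρ ∧
        (∀ i, S i ≠ 0 → i ∈ (ifp W (N₁ + n)).young) ∧
        ∀ i ∈ (ifp W (N₁ + n)).young, (∃ s, N₁ ≤ s ∧ s < N₁ + n ∧ (W.j s = i ∨ W.b s i ≠ 0)) →
          (ifp W (N₁ + n)).muPD (p ^ e) i = ((((S i : ℕ) : ℚ) / (p ^ e - J₀.degree : ℕ) : ℚ) : WithTop ℚ) := by
  induction n with
  | zero =>
    obtain ⟨J₀, hJ₀, hμ, S, ρ, hρ, hd₀, hG, hyoung⟩ := hy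
    refine ⟨J₀, hJ₀, hμ, S, ρ, hρ, hd₀, hG, hyoung, fun i _ hloss => ?_⟩
    obtain ⟨s, hs₁, hs₂, -⟩ := hloss
    omega
  | succ n ih =>
    obtain ⟨J₀, hJ₀, hμ, S, ρ, hρ, hd₀, hG, hyoung, hdef⟩ := ih
    have ht : N₁ ≤ N₁ + n := Nat.le_add_right _ _
    obtain ⟨S', ρ', hρ', hJ₁, hμ₁, hd₁, hG₁, hyoung', hnew, hS'kept, hkept⟩ :=
      deficiency_step hp hs W (N₁ + n) (hst _ ht) (hcl _ ht) hJ₀ hμ S hρ hd₀ hG hyoung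
    refine ⟨J₀, hJ₁, hμ₁, S', ρ', hρ', hd₁, hG₁, hyoung', fun i hi hloss => ?_⟩
    by_cases hij : i = W.j (N₁ + n)
    · subst hij; exact hnew
    · -- a young letter other than the new one was young AND untranslated at the move `N₁ + n`
      have hi' : i ∈ (ifp W (N₁ + n)).young ∧ W.b (N₁ + n) i = 0 := by
        have h := hi
        rw [show N₁ + (n + 1) = N₁ + n + 1 from rfl, ifp_succ] at h
        change i ∈ insert (W.j (N₁ + n)) ((ifp W (N₁ + n)).young.filter fun i => W.b (N₁ + n) i = 0) at h
        rw [Finset.mem_insert, Finset.mem_filter] at h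
        rcases h with h | h
        · exact absurd h hij
        · exact h
      refine hkept i hij hi'.2 (hdef i hi'.1 ?_)
      obtain ⟨s, hs₁, hs₂, hls⟩ := hloss
      refine ⟨s, hs₁, ?_, hls⟩
      rcases Nat.lt_or_ge s (N₁ + n) with hlt | hge
      · exact hlt
      · exfalso
        have hsn : s = N₁ + n := by omega
        subst hsn
        rcases hls with h | h
        · exact hij h.symm
        · exact h hi'.2

/-- **THE DEFICIENCY LAW.**  A clean stalled monomial regime from `N₁` on a SKEW tail (every letter is lost after any
given time) is EVENTUALLY FLAT: from some `T ≥ N₁` on, at every time the followed minimiser's cone is a young monomial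
all of whose young letters are non-deficient — the cone IS the boundary monomial. [new] [folklore] -/
theorem eventually_flat {K : Type} [Field K] [DecidableEq K] {p e : ℕ} (hp : p.Prime) [CharP K p]
    {s₀ : State (Fin 3) K} (hs : IsRoot (p ^ e) s₀) (W : ForcedWalk (p ^ e) s₀) (N₁ : ℕ)
    (hst : ∀ t, N₁ ≤ t → (ifp W (t + 1)).muTilde (p ^ e) = (ifp W t).muTilde (p ^ e))
    (hcl : ∀ t, N₁ ≤ t → CleanAt W t) (hy : YoungMonomialAt W N₁)
    (hskew : ∀ (k : Fin 3) (N' : ℕ), ∃ t, N' ≤ t ∧ (W.j t = k ∨ W.b t k ≠ 0)) :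
    ∃ T, N₁ ≤ T ∧ ∀ t, T ≤ t → FlatMonomialAt W t := by
  choose τ hτ using fun k : Fin 3 => hskew k N₁
  refine ⟨N₁ + (Finset.univ.sup (fun k => τ k - N₁) + 1), Nat.le_add_right _ _, fun t ht => ?_⟩
  obtain ⟨n, rfl⟩ := Nat.exists_eq_add_of_le (le_trans (Nat.le_add_right N₁ _) ht)
  obtain ⟨J₀, hJ₀, hμ, S, ρ, hρ, hd₀, hG, hyoung, hdef⟩ := deficiency_iterate hp hs W N₁ hst hcl hy n
  refine ⟨J₀, hJ₀, hμ, S, ρ, hρ, hd₀, hG, hyoung, fun i hi => hdef i hi ⟨τ i, (hτ i).1, ?_, (hτ i).2⟩⟩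
  have h1 : τ i - N₁ ≤ Finset.univ.sup (fun k => τ k - N₁) :=
    Finset.le_sup (f := fun k => τ k - N₁) (Finset.mem_univ i)
  omega

/-- **`μ̃ ≡ 0` IN THE MONOMIAL REGIME OF A SKEW STALLED TAIL**: `μ̃` is constant from `N` (stall) and vanishes from the
flat time on. [new] [folklore] -/
theorem muTilde_eq_zero_of_regime {K : Type} [Field K] [DecidableEq K] {p e : ℕ} (hp : p.Prime) [CharP K p]
    {s₀ : State (Fin 3) K} (hs : IsRoot (p ^ e) s₀) (W : ForcedWalk (p ^ e) s₀) (N N₁ : ℕ) (hN₁ : N ≤ N₁)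
    (hstall : ∀ t, N ≤ t → (ifp W (t + 1)).muTilde (p ^ e) = (ifp W t).muTilde (p ^ e))
    (hcl : ∀ t, N₁ ≤ t → CleanAt W t) (hy : YoungMonomialAt W N₁)
    (hskew : ∀ (k : Fin 3) (N' : ℕ), ∃ t, N' ≤ t ∧ (W.j t = k ∨ W.b t k ≠ 0)) :
    ∀ t, N ≤ t → (ifp W t).muTilde (p ^ e) = 0 := by
  obtain ⟨T, hT, hflat⟩ := eventually_flat hp hs W N₁ (fun t ht => hstall t (le_trans hN₁ ht)) hcl hy hskew
  have h0 : (ifp W N).muTilde (p ^ e) = 0 := by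
    rw [← muTilde_eq_of_stall W hstall (le_trans hN₁ hT)]
    exact muTilde_eq_zero_of_flatMonomialAt W T (hflat T le_rfl)
  intro t ht
  rw [muTilde_eq_of_stall W hstall ht, h0]

end Classes

end Summit.ResolutionOfSingularities.ResolutionOfSingularities.Theorems.StallVertex
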